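import Summits.QuantumFields.BalabanUV.Beta.GAN24.FaceReadCrossedValueZero
import Summits.QuantumFields.BalabanUV.Beta.GAN24.WilsonProfilePairing

/-!
# `BalabanUV.Beta.GAN24.FaceReadCrossedValueZeroClosed` — binder row G-an2-4 ∕ (CONV-C), W-slot (α-0), typer's PART VI row **T6-VAL**, the (γ) hand's letter **K7-0, THE `E2 d Lc 0` HALF IN
# CLOSED FORM**: in `FaceReadCrossedValueZero.crossed_faceRead_dressedStep_zero` (road-P2's literal LS face read of the level-0 dressed source at the crossed pattern `(a₀b₀;a₀b₀)`) the two
# `E2 d Lc 0`-cell pairings of K2's face profiles at period `Lc·P` are RATIONAL NUMBERS by this hand's `WilsonProfilePairing.sum_box_qProfile_E2zero_qProfile` (`E2 d Lc 0 = d*d`, the Wilson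
# Hessian): on both crossed patterns `(b₀,a₀;a₀,b₀)` and `(a₀,b₀;b₀,a₀)` the pattern sign is `[μ=ν][α=β] − [μ=β][α=ν] = 0 − 1`, so each equals `2·(0 − 1)·(Lc·P)^{d−1}·(1 − (Lc·P)⁻²)`.  What is
# left symbolic is the `E2 d Lc 1` half (the level-1 value Hessian's cell pairing at period `P` = `CrossedLedgerClosure`'s potential term `G 1 m`; its closed form is K2 ∕ (Q-L)'s business):
# the statement is leaf-03 g72's `hface0 : Xf 0 m = W m − G 1 m` with `W m` an explicit rational multiple of `c·K₀⁴·((sf·sm)⁻¹sf⁻²cE)²·sf²·(wVH d Lc 0)⁻¹`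
# (G-an2-4 CRUX TEAM (2), seat `b2b-balaban-gan24-formalise-leaf-06` = the (γ) hand, gen 57; journal [GAN24LEAF06-G57-INTENT-7]; memo `g57/K7-ZERO-g57.md` §7)

NOT IN PRINT; OUR PROOF ([folklore]: `FaceReadCrossedValueZero.crossed_faceRead_dressedStep_zero` and `WilsonProfilePairing.sum_box_qProfile_E2zero_qProfile` BY NAME, two `if_neg ∕ if_pos`;
0 `def`, 0 cited fact, 0 `def … : Prop`, 0 sorry).  HONEST FRAMING (cell contract, verbatim): «discharging `BetaPertH` makes Bałaban's UV stability UNCONDITIONAL — a real constructive-QFT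
result; it is NOT the continuum limit and NOT the Clay problem.»  HONEST DEPENDENCY (verbatim): «continuum YM on T⁴ ⇐ BetaPertH ∧ nine spine estimates (0/9 proved); BetaPertH ⇐ (D1) ∧ (D4) ∧
CAP+tail; G-an2-4 gates asym, D1 and NE2/3/4.»  NOT `hXu` (the pin number `−4·Lc⁸·(Lc²P²−1)` also needs the pins `d = 3`, `cE = Lc⁴`, `c = cE₂·Lc⁸`, `sf = sm = 1`, `wVH d Lc 0 = 1` and
leaf-03's bookkeeping of `G 1 m` — not done here); F5 rows `hSrow ∕ hMrow` stay HYPOTHESES; discharges NOTHING of `hX` ∕ (C) ∕ `hB0` ∕ `hBF` ∕ (Q-L); NEVER «G-an2-4 closed» as (CONV-C);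
NOT D1, NOT `BetaPertH`, NOT continuum, NOT Clay.  2026-08-24; no existing file touched.
v1.1 (leaf-06 g58): `locStencil₂_zero'` dropped from the `open` list of 50c's names (unused here; 50c drops that twin at filing); nothing else changed.
-/

noncomputable section

open Finset
open scoped BigOperators
open Literature.MathematicalPhysics.QuantumFieldTheory
open Literature.MathematicalPhysics.QuantumFieldTheory.Balaban1983to89
open Literature.MathematicalPhysics.QuantumFieldTheory.Balaban1983to89.Beta
open B12Sec2to5 (l1)
open ExpKernelCalculus (Site MKer Decays BiLoc VertexFamily VertexFamily₂ shiftK comp)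
open OneStepResolventKernel (Fib LocStencil biLoc_mono)
open BalabanCompositeJets (LocStencil₂)
open AffineAveraging (box toSite)
open OneStepKernelFamily (KInvStep decays_KInvStep shiftK_KInvStep)
open SecondOrderResponse (dM K2OfK W2SymOfK LocStencilFM vertexFamily₂_W2SymOfK')
open BalabanStepW2 (K3OfK)
open BalabanStepJetsSucc (mmRead)
open BalabanStepJets (locStencil_mono)
open Summit.QuantumFields.BalabanUV.Beta.TameKernelCalculus (Loc trK)
open Summit.QuantumFields.BalabanUV.Beta.BorderedHessian (stepScale sgnK)
open Summit.QuantumFields.BalabanUV.Beta.AxialDressingRooted (coDressKBmAt shiftK_coDressKBmAt decays_coDressKBmAt)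
open Summit.QuantumFields.BalabanUV.Beta.HessKerDressedUnits (unitK decays_unitK)
open Summit.QuantumFields.BalabanUV.Beta.GAN24.BiStencilZeroMode (Tab)
open Summit.QuantumFields.BalabanUV.Beta.GAN24.FaceWordsDeepCurrents (summable_word_coarse summable_word_coarse_right)
open Summit.QuantumFields.BalabanUV.Beta.GAN24.DressedVertexFacePush (tsum_faceBond_dM_dressedStep exists_vertexFamily_dM_dressedStep
  dM_dressedStep_translate_coarse)
open Summit.QuantumFields.BalabanUV.Beta.GAN24.FourFaceSourceWordsDeep (faceRead_dressedSource_inl_inl)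
open Summit.QuantumFields.BalabanUV.Beta.GAN24.FaceWWordLetters (locStencilFM_mono)
open Summit.QuantumFields.BalabanUV.Beta.GAN24.FaceWWordSummable (summable_faceWord_W2SymOfK_zero₂)
open Summit.QuantumFields.BalabanUV.Beta.GAN24.FaceWWordVanishing (faceWWord_LS_eq_zero)
open OneStepKernelFamily (KInvStep)
open BalabanStepJetsSucc (E2 wVH)
open Summit.QuantumFields.BalabanUV.Beta.HessKerDressedUnits (unitS)
open Summit.QuantumFields.BalabanUV.Beta.SpineRooted (SpureRecAt)
open Summit.QuantumFields.BalabanUV.Beta.GAN24.ForcingFacePairFormAssembly (ite_and_three)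
open Summit.QuantumFields.BalabanUV.Beta.GAN24.CrossedFromThreeWords (crossed_of_threeWords)
open Summit.QuantumFields.BalabanUV.Beta.GAN24.FaceWordFullZero (fullTable0_translate exists_common_rate_full0 faceWordFull_zero_value)
open Summit.QuantumFields.BalabanUV.Beta.GAN24.FaceWordFullZeroPatterns (faceWordFull_zero_eq_zero_of_left_diag faceWordFull_swap_zero_value
  faceWordFull_swap_zero_eq_zero_of_left_diag)

open Summit.QuantumFields.BalabanUV.Beta.GAN24.FaceReadCrossedValueZero (crossed_faceRead_dressedStep_zero)
open Summit.QuantumFields.BalabanUV.Beta.GAN24.WilsonProfilePairing (sum_box_qProfile_E2zero_qProfile)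

namespace Summit.QuantumFields.BalabanUV.Beta.GAN24.FaceReadCrossedValueZeroClosed

variable {d : ℕ} {Lc : ℕ} [NeZero Lc] {r : Fin (d + 1) → ℕ}

/-- NOT IN PRINT; OUR PROOF.  **K7-0 WITH THE `E2 d Lc 0` HALF IN CLOSED FORM** (module docstring): `FaceReadCrossedValueZero.crossed_faceRead_dressedStep_zero` with both level-0 Wilson-Hessian
cell pairings evaluated to `2·(0 − 1)·(Lc·P)^{d−1}·(1 − (Lc·P)⁻¹(Lc·P)⁻¹)`. -/
theorem crossed_faceRead_dressedStep_zero_closedE0 (hLc : 1 ≤ Lc) (hr : r ∈ box (d + 1) Lc) {P : ℕ} (hP : 1 ≤ P) (sf sm cE cVH cΛ : ℝ)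
    {M : Fin (d + 1) → Site (d + 1) → MKer (d + 1) (Fib d)} {CM δM : ℝ} (hM : VertexFamily M Lc CM δM) (hδM : 0 < δM)
    (hMt : ∀ (ρ : Fin (d + 1)) (w t : Site (d + 1)), M ρ (w + t) = shiftK (-((Lc : ℤ) • t)) (M ρ w))
    (hSrow : ∀ κ u, trK ((unitS sf sm (SpureRecAt d Lc (toSite r) cE cVH cΛ 0)) κ u) = -sgnK ((unitS sf sm (SpureRecAt d Lc (toSite r) cE cVH cΛ 0)) κ u)) (hMrow : ∀ ρ w, trK (M ρ w) = -sgnK (M ρ w))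
    {M₂ : Fin (d + 1) → Site (d + 1) → Fin (d + 1) → Site (d + 1) → MKer (d + 1) (Fib d)} {C₂ δ₂ : ℝ} (hM₂ : LocStencilFM Lc M₂ C₂ δ₂) (hδ₂ : 0 < δ₂)
    (hM₂t : ∀ (κ : Fin (d + 1)) (u : Site (d + 1)) (ρ : Fin (d + 1)) (w t : Site (d + 1)), M₂ κ (u + (Lc : ℤ) • t) ρ (w + t) = shiftK (-((Lc : ℤ) • t)) (M₂ κ u ρ w))
    {B : Tab d} (hBff : ∀ κ u κ' u' x z (α β : Fin (d + 1)), B κ u κ' u' x z (Sum.inl α) (Sum.inl β) = 0) (c cB : ℝ)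
    {a₀ b₀ : Fin (d + 1)} (hab : a₀ ≠ b₀) :
        ((fun μ ν α β : Fin (d + 1) => ∑ r' ∈ box (d + 1) P, ∑' u' : Site (d + 1), ∑' x : Site (d + 1), ∑' z : Site (d + 1),
            (if toSite r' μ % (P : ℤ) = (P : ℤ) - 1 ∧ u' ν % (P : ℤ) = (P : ℤ) - 1 ∧ x α % (P : ℤ) = (P : ℤ) - 1 ∧ z β % (P : ℤ) = (P : ℤ) - 1 then
              (c • mmRead Lc (K3OfK (unitK sf sm (coDressKBmAt (toSite r) Lc (KInvStep (d := d) Lc 0))) Lc (unitS sf sm (SpureRecAt d Lc (toSite r) cE cVH cΛ 0)) M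
                  (W2SymOfK (unitK sf sm (coDressKBmAt (toSite r) Lc (KInvStep (d := d) Lc 0))) Lc (unitS sf sm (SpureRecAt d Lc (toSite r) cE cVH cΛ 0)) M 0 M₂) μ (toSite r') ν u')
                + cB • B μ (toSite r') ν u') x z (Sum.inl α) (Sum.inl β) else 0)) a₀ b₀ a₀ b₀
          + (fun μ ν α β : Fin (d + 1) => ∑ r' ∈ box (d + 1) P, ∑' u' : Site (d + 1), ∑' x : Site (d + 1), ∑' z : Site (d + 1),
            (if toSite r' μ % (P : ℤ) = (P : ℤ) - 1 ∧ u' ν % (P : ℤ) = (P : ℤ) - 1 ∧ x α % (P : ℤ) = (P : ℤ) - 1 ∧ z β % (P : ℤ) = (P : ℤ) - 1 then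
              (c • mmRead Lc (K3OfK (unitK sf sm (coDressKBmAt (toSite r) Lc (KInvStep (d := d) Lc 0))) Lc (unitS sf sm (SpureRecAt d Lc (toSite r) cE cVH cΛ 0)) M
                  (W2SymOfK (unitK sf sm (coDressKBmAt (toSite r) Lc (KInvStep (d := d) Lc 0))) Lc (unitS sf sm (SpureRecAt d Lc (toSite r) cE cVH cΛ 0)) M 0 M₂) μ (toSite r') ν u')
                + cB • B μ (toSite r') ν u') x z (Sum.inl α) (Sum.inl β) else 0)) b₀ a₀ a₀ b₀)
        + ((fun μ ν α β : Fin (d + 1) => ∑ r' ∈ box (d + 1) P, ∑' u' : Site (d + 1), ∑' x : Site (d + 1), ∑' z : Site (d + 1),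
            (if toSite r' μ % (P : ℤ) = (P : ℤ) - 1 ∧ u' ν % (P : ℤ) = (P : ℤ) - 1 ∧ x α % (P : ℤ) = (P : ℤ) - 1 ∧ z β % (P : ℤ) = (P : ℤ) - 1 then
              (c • mmRead Lc (K3OfK (unitK sf sm (coDressKBmAt (toSite r) Lc (KInvStep (d := d) Lc 0))) Lc (unitS sf sm (SpureRecAt d Lc (toSite r) cE cVH cΛ 0)) M
                  (W2SymOfK (unitK sf sm (coDressKBmAt (toSite r) Lc (KInvStep (d := d) Lc 0))) Lc (unitS sf sm (SpureRecAt d Lc (toSite r) cE cVH cΛ 0)) M 0 M₂) μ (toSite r') ν u')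
                + cB • B μ (toSite r') ν u') x z (Sum.inl α) (Sum.inl β) else 0)) b₀ a₀ a₀ b₀
          + (fun μ ν α β : Fin (d + 1) => ∑ r' ∈ box (d + 1) P, ∑' u' : Site (d + 1), ∑' x : Site (d + 1), ∑' z : Site (d + 1),
            (if toSite r' μ % (P : ℤ) = (P : ℤ) - 1 ∧ u' ν % (P : ℤ) = (P : ℤ) - 1 ∧ x α % (P : ℤ) = (P : ℤ) - 1 ∧ z β % (P : ℤ) = (P : ℤ) - 1 then
              (c • mmRead Lc (K3OfK (unitK sf sm (coDressKBmAt (toSite r) Lc (KInvStep (d := d) Lc 0))) Lc (unitS sf sm (SpureRecAt d Lc (toSite r) cE cVH cΛ 0)) M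
                  (W2SymOfK (unitK sf sm (coDressKBmAt (toSite r) Lc (KInvStep (d := d) Lc 0))) Lc (unitS sf sm (SpureRecAt d Lc (toSite r) cE cVH cΛ 0)) M 0 M₂) μ (toSite r') ν u')
                + cB • B μ (toSite r') ν u') x z (Sum.inl α) (Sum.inl β) else 0)) a₀ b₀ a₀ b₀)
        + (((fun μ ν α β : Fin (d + 1) => ∑ r' ∈ box (d + 1) P, ∑' u' : Site (d + 1), ∑' x : Site (d + 1), ∑' z : Site (d + 1),
            (if toSite r' μ % (P : ℤ) = (P : ℤ) - 1 ∧ u' ν % (P : ℤ) = (P : ℤ) - 1 ∧ x α % (P : ℤ) = (P : ℤ) - 1 ∧ z β % (P : ℤ) = (P : ℤ) - 1 then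
              (c • mmRead Lc (K3OfK (unitK sf sm (coDressKBmAt (toSite r) Lc (KInvStep (d := d) Lc 0))) Lc (unitS sf sm (SpureRecAt d Lc (toSite r) cE cVH cΛ 0)) M
                  (W2SymOfK (unitK sf sm (coDressKBmAt (toSite r) Lc (KInvStep (d := d) Lc 0))) Lc (unitS sf sm (SpureRecAt d Lc (toSite r) cE cVH cΛ 0)) M 0 M₂) μ (toSite r') ν u')
                + cB • B μ (toSite r') ν u') x z (Sum.inl α) (Sum.inl β) else 0)) a₀ b₀ b₀ a₀
          + (fun μ ν α β : Fin (d + 1) => ∑ r' ∈ box (d + 1) P, ∑' u' : Site (d + 1), ∑' x : Site (d + 1), ∑' z : Site (d + 1),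
            (if toSite r' μ % (P : ℤ) = (P : ℤ) - 1 ∧ u' ν % (P : ℤ) = (P : ℤ) - 1 ∧ x α % (P : ℤ) = (P : ℤ) - 1 ∧ z β % (P : ℤ) = (P : ℤ) - 1 then
              (c • mmRead Lc (K3OfK (unitK sf sm (coDressKBmAt (toSite r) Lc (KInvStep (d := d) Lc 0))) Lc (unitS sf sm (SpureRecAt d Lc (toSite r) cE cVH cΛ 0)) M
                  (W2SymOfK (unitK sf sm (coDressKBmAt (toSite r) Lc (KInvStep (d := d) Lc 0))) Lc (unitS sf sm (SpureRecAt d Lc (toSite r) cE cVH cΛ 0)) M 0 M₂) μ (toSite r') ν u')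
                + cB • B μ (toSite r') ν u') x z (Sum.inl α) (Sum.inl β) else 0)) b₀ a₀ b₀ a₀)
        + ((fun μ ν α β : Fin (d + 1) => ∑ r' ∈ box (d + 1) P, ∑' u' : Site (d + 1), ∑' x : Site (d + 1), ∑' z : Site (d + 1),
            (if toSite r' μ % (P : ℤ) = (P : ℤ) - 1 ∧ u' ν % (P : ℤ) = (P : ℤ) - 1 ∧ x α % (P : ℤ) = (P : ℤ) - 1 ∧ z β % (P : ℤ) = (P : ℤ) - 1 then
              (c • mmRead Lc (K3OfK (unitK sf sm (coDressKBmAt (toSite r) Lc (KInvStep (d := d) Lc 0))) Lc (unitS sf sm (SpureRecAt d Lc (toSite r) cE cVH cΛ 0)) M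
                  (W2SymOfK (unitK sf sm (coDressKBmAt (toSite r) Lc (KInvStep (d := d) Lc 0))) Lc (unitS sf sm (SpureRecAt d Lc (toSite r) cE cVH cΛ 0)) M 0 M₂) μ (toSite r') ν u')
                + cB • B μ (toSite r') ν u') x z (Sum.inl α) (Sum.inl β) else 0)) b₀ a₀ b₀ a₀
          + (fun μ ν α β : Fin (d + 1) => ∑ r' ∈ box (d + 1) P, ∑' u' : Site (d + 1), ∑' x : Site (d + 1), ∑' z : Site (d + 1),
            (if toSite r' μ % (P : ℤ) = (P : ℤ) - 1 ∧ u' ν % (P : ℤ) = (P : ℤ) - 1 ∧ x α % (P : ℤ) = (P : ℤ) - 1 ∧ z β % (P : ℤ) = (P : ℤ) - 1 then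
              (c • mmRead Lc (K3OfK (unitK sf sm (coDressKBmAt (toSite r) Lc (KInvStep (d := d) Lc 0))) Lc (unitS sf sm (SpureRecAt d Lc (toSite r) cE cVH cΛ 0)) M
                  (W2SymOfK (unitK sf sm (coDressKBmAt (toSite r) Lc (KInvStep (d := d) Lc 0))) Lc (unitS sf sm (SpureRecAt d Lc (toSite r) cE cVH cΛ 0)) M 0 M₂) μ (toSite r') ν u')
                + cB • B μ (toSite r') ν u') x z (Sum.inl α) (Sum.inl β) else 0)) a₀ b₀ b₀ a₀))
          = 4 * ((c * -(((sf * sm) * (stepScale d Lc 0 * (Lc : ℝ) ^ (d + 1))⁻¹) * ((sf * sm) * (stepScale d Lc 0 * (Lc : ℝ) ^ (d + 1))⁻¹))) * (((sf * sm) * (stepScale d Lc 0 * (Lc : ℝ) ^ (d + 1))⁻¹) * ((sf * sm) * (stepScale d Lc 0 * (Lc : ℝ) ^ (d + 1))⁻¹))) *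
            ((((sf * sm)⁻¹ * (sf⁻¹ * sf⁻¹) * cE) * ((sf * sm)⁻¹ * (sf⁻¹ * sf⁻¹) * cE)) *
      ((-(1 / 2 : ℝ)) * (1 / 2 : ℝ) * ((sf * sf) *
        ((wVH d Lc 0)⁻¹ *
            (2 * ((0 : ℝ) - 1) * ((((Lc * P : ℕ) : ℝ)) ^ (d - 1) * (1 - (((Lc * P : ℕ) : ℝ))⁻¹ * (((Lc * P : ℕ) : ℝ))⁻¹))) -
          (wVH d Lc 0)⁻¹ * (((Lc : ℝ) ^ (d + 1) * (Lc : ℝ) ^ (d + 1)) *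
            ∑ y ∈ box (d + 1) P, ∑ a : Fin (d + 1),
              ((if a = b₀ then (((P : ℝ))⁻¹ * ((P : ℝ))⁻¹) * ((((toSite y a₀ % (P : ℤ)) : ℤ) : ℝ) - ((P : ℝ) - 1) / 2) else 0)
                + (if a = a₀ then (-((P : ℝ))⁻¹ * ((((toSite y b₀ % (P : ℤ)) : ℤ) : ℝ) - ((P : ℝ) - 1) / 2)) *
                    (if toSite y a₀ % (P : ℤ) = (P : ℤ) - 1 then (1 : ℝ) else 0) else 0)) *
              ∑' s : Site (d + 1), ∑ b' : Fin (d + 1), E2 d Lc 1 (toSite y) s (Sum.inl a) (Sum.inl b') *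
                ((if b' = a₀ then (((P : ℝ))⁻¹ * ((P : ℝ))⁻¹) * ((((s b₀ % (P : ℤ)) : ℤ) : ℝ) - ((P : ℝ) - 1) / 2) else 0)
                  + (if b' = b₀ then (-((P : ℝ))⁻¹ * ((((s a₀ % (P : ℤ)) : ℤ) : ℝ) - ((P : ℝ) - 1) / 2)) *
                      (if s b₀ % (P : ℤ) = (P : ℤ) - 1 then (1 : ℝ) else 0) else 0))))))
            + (((sf * sm)⁻¹ * (sf⁻¹ * sf⁻¹) * cE) * ((sf * sm)⁻¹ * (sf⁻¹ * sf⁻¹) * cE)) *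
      ((-(1 / 2 : ℝ)) * (1 / 2 : ℝ) * ((sf * sf) *
        ((wVH d Lc 0)⁻¹ *
            (2 * ((0 : ℝ) - 1) * ((((Lc * P : ℕ) : ℝ)) ^ (d - 1) * (1 - (((Lc * P : ℕ) : ℝ))⁻¹ * (((Lc * P : ℕ) : ℝ))⁻¹))) -
          (wVH d Lc 0)⁻¹ * (((Lc : ℝ) ^ (d + 1) * (Lc : ℝ) ^ (d + 1)) *
            ∑ y ∈ box (d + 1) P, ∑ a : Fin (d + 1),
              ((if a = a₀ then (((P : ℝ))⁻¹ * ((P : ℝ))⁻¹) * ((((toSite y b₀ % (P : ℤ)) : ℤ) : ℝ) - ((P : ℝ) - 1) / 2) else 0)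
                + (if a = b₀ then (-((P : ℝ))⁻¹ * ((((toSite y a₀ % (P : ℤ)) : ℤ) : ℝ) - ((P : ℝ) - 1) / 2)) *
                    (if toSite y b₀ % (P : ℤ) = (P : ℤ) - 1 then (1 : ℝ) else 0) else 0)) *
              ∑' s : Site (d + 1), ∑ b' : Fin (d + 1), E2 d Lc 1 (toSite y) s (Sum.inl a) (Sum.inl b') *
                ((if b' = b₀ then (((P : ℝ))⁻¹ * ((P : ℝ))⁻¹) * ((((s a₀ % (P : ℤ)) : ℤ) : ℝ) - ((P : ℝ) - 1) / 2) else 0)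
                  + (if b' = a₀ then (-((P : ℝ))⁻¹ * ((((s b₀ % (P : ℤ)) : ℤ) : ℝ) - ((P : ℝ) - 1) / 2)) *
                      (if s a₀ % (P : ℤ) = (P : ℤ) - 1 then (1 : ℝ) else 0) else 0))))))) := by
  haveI : NeZero P := ⟨by omega⟩
  have hM1 : 1 ≤ Lc * P := Nat.mul_pos (by omega) (by omega)
  have h := crossed_faceRead_dressedStep_zero (d := d) hLc hr hP sf sm cE cVH cΛ hM hδM hMt hSrow hMrow hM₂ hδ₂ hM₂t hBff c cB hab
  have hA1 := sum_box_qProfile_E2zero_qProfile (d := d) Lc hM1 (μ := b₀) (α := a₀) (ν := a₀) (β := b₀) hab.symm hab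
  have hA2 := sum_box_qProfile_E2zero_qProfile (d := d) Lc hM1 (μ := a₀) (α := b₀) (ν := b₀) (β := a₀) hab hab.symm
  rw [if_neg (fun h' => hab.symm h'.1), if_pos ⟨rfl, rfl⟩] at hA1
  rw [if_neg (fun h' => hab h'.1), if_pos ⟨rfl, rfl⟩] at hA2
  rw [hA1, hA2] at h
  exact h

end Summit.QuantumFields.BalabanUV.Beta.GAN24.FaceReadCrossedValueZeroClosed

end
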